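import Mathlib
import Summits.MatrixMultiplication.MatrixMultiplication.Theorems.SnSubsetDichotomyPolynomialSlackHubBlockCard
import Summits.MatrixMultiplication.MatrixMultiplication.Theorems.SnSubsetDichotomyPolynomialSlackHubBlockVolume
import Summits.MatrixMultiplication.MatrixMultiplication.Theorems.SnSubsetDichotomyPolynomialSlackLevelPigeonhole
import Summits.MatrixMultiplication.MatrixMultiplication.Theorems.SnSubsetDichotomyPolynomialSlackDyadicLevels
import Summits.MatrixMultiplication.MatrixMultiplication.Theorems.SnSubsetDichotomyPolynomialSlackMarginals

/-!
# The general hub lemma (dyadic form)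

Crux `Summit.MatrixMultiplication.MatrixMultiplication.Theses.SnSubsetDichotomy.PolynomialSlack`
(item `stmt-MatrixMultiplication-8306`), level-one programme, line transport-split-hull, lead c8
(general hub lemma, assembly). For a TPP triple `S, T, U ⊆ S_n` of non-empty sets with quotient profiles
`d_A, d_B, d_C`, a hub position `k` of `U`, a set `J` of `T`-positions and a set `I` of `S`-positions whose
links to the hub have density at least `1/n²` (`d_B(j,k), d_C(k,i) ≥ 1/n²`), hub mass
`Σ_v μ(v) X_J(v) Y_I(v) ≥ 2q` (`μ` the value distribution of `U` at `k`, `X_J, Y_I` the block profiles of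
`T`, `S`) and block weight `Σ_{I × J} d_A d_B d_C ≤ η/n` with `81(1+log n)⁴η ≤ 2q²`:

  `|S||T||U| ≤ 9600²·9⁴·(1+log n)^{10}·log²(6·n!/(|S||T|))·n·η·B/q⁴`     (`hub_volume_dyadic`)

for every bound `B` on the volumes of TPP triples of `S_{n-1}`. Proof: split `J` and `I` into the
dyadic LEVELS of their link densities (`dyadicLevel_bounds/mono/count`: at most `3(1+log n)` levels
each); the hub mass is bi-additive over blocks (`card_filter_inv_apply_mem`), so one level block
`J₀ × I₀` carries hub mass `≥ 2q/(9(1+log n)²) =: 2q'` (`levelBlock_pigeonhole`); on it the links lie in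
dyadic ranges, the block cost bounds `|J₀||I₀| ≤ 9600(1+log n)·n·log(6n!/(|S||T|))`
(`hubBlock_card_le`) and the block volume bound (`hubBlock_volume_le`) concludes.
-/

namespace Summit.MatrixMultiplication.MatrixMultiplication.Theorems.PolynomialSlack

open scoped BigOperators
open Literature.Combinatorics.Additive (TripleProductProperty)

-- `Summit.<Summit>.<Problem>` is the tree's mandated summit-side namespace (CONVENTIONS §2); for
-- this single-conjunct summit the two coincide, so each declaration silences `dupNamespace`.
set_option linter.dupNamespace false

/-- Bi-additivity of the hub mass: for every value distribution `μ` and blocks `J', I'`,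
`Σ_v μ(v)·(#{t : t⁻¹v ∈ J'}/c_T)·(#{s : s⁻¹v ∈ I'}/c_S) = Σ_{j ∈ J'} Σ_{i ∈ I'} g(j,i)` with
`g(j,i) = Σ_v μ(v)·(#{t : t j = v}/c_T)·(#{s : s i = v}/c_S)` (`card_filter_inv_apply_mem`). [folklore] -/
theorem hubDyadic_mass_eq_sum_blocks {n : ℕ} (S T : Finset (Equiv.Perm (Fin n))) (μ : Fin n → ℝ)
    (cS cT : ℝ) (J' I' : Finset (Fin n)) :
    ∑ v : Fin n, μ v * (((T.filter fun t => t⁻¹ v ∈ J').card : ℝ) / cT) *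
        (((S.filter fun s => s⁻¹ v ∈ I').card : ℝ) / cS) =
      ∑ j ∈ J', ∑ i ∈ I', ∑ v : Fin n, μ v * (((T.filter fun t => t j = v).card : ℝ) / cT) *
        (((S.filter fun s => s i = v).card : ℝ) / cS) := by
  have hT : ∀ v, ((T.filter fun t => t⁻¹ v ∈ J').card : ℝ) =
      ∑ j ∈ J', ((T.filter fun t => t j = v).card : ℝ) := fun v => by
    exact_mod_cast card_filter_inv_apply_mem T J' v
  have hS : ∀ v, ((S.filter fun s => s⁻¹ v ∈ I').card : ℝ) =
      ∑ i ∈ I', ((S.filter fun s => s i = v).card : ℝ) := fun v => by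
    exact_mod_cast card_filter_inv_apply_mem S I' v
  calc ∑ v : Fin n, μ v * (((T.filter fun t => t⁻¹ v ∈ J').card : ℝ) / cT) *
        (((S.filter fun s => s⁻¹ v ∈ I').card : ℝ) / cS)
      = ∑ v : Fin n, ∑ j ∈ J', ∑ i ∈ I', μ v * (((T.filter fun t => t j = v).card : ℝ) / cT) *
          (((S.filter fun s => s i = v).card : ℝ) / cS) := by
        refine Finset.sum_congr rfl fun v _ => ?_
        rw [hT v, hS v, Finset.sum_div, Finset.sum_div, mul_assoc, Finset.sum_mul_sum, Finset.mul_sum]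
        refine Finset.sum_congr rfl fun j _ => ?_
        rw [Finset.mul_sum]
        exact Finset.sum_congr rfl fun i _ => by ring
    _ = ∑ j ∈ J', ∑ v : Fin n, ∑ i ∈ I', μ v * (((T.filter fun t => t j = v).card : ℝ) / cT) *
          (((S.filter fun s => s i = v).card : ℝ) / cS) := Finset.sum_comm
    _ = _ := Finset.sum_congr rfl fun j _ => Finset.sum_comm

set_option maxHeartbeats 1600000 in
/-- **The general hub lemma (dyadic form).** For `n ≥ 2`, a bound `B` on the volumes of TPP triples
of `S_{n-1}`, a TPP triple `S, T, U ⊆ S_n` of non-empty sets with quotient profiles `dA, dB, dC`, a hub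
position `k`, blocks `J, I` with links `dB j k ≥ 1/n²` (`j ∈ J`), `dC k i ≥ 1/n²` (`i ∈ I`), hub mass
`Σ_v μ(v)·X_J(v)·Y_I(v) ≥ 2q`, block weight `Σ_{I × J} dA·dB·dC ≤ η/n` (`q, η > 0`) and
`81(1+log n)⁴·η ≤ 2q²`:
`|S||T||U| ≤ 9600²·9⁴·(1+log n)^{10}·log²(6n!/(|S||T|))·n·η·B/q⁴`. [folklore] -/
theorem hub_volume_dyadic {n : ℕ} (hn : 2 ≤ n) (B : ℕ)
    (hB : ∀ S' T' U' : Finset (Equiv.Perm (Fin (n - 1))), TripleProductProperty S' T' U' →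
      S'.card * T'.card * U'.card ≤ B)
    {S T U : Finset (Equiv.Perm (Fin n))} (hTPP : TripleProductProperty S T U)
    (hS0 : S.Nonempty) (hT0 : T.Nonempty) (hU0 : U.Nonempty)
    (dA dB dC : Fin n → Fin n → ℝ)
    (hdA : ∀ i j, dA i j = (((S ×ˢ T).filter fun st => st.2 j = st.1 i).card : ℝ) / (S.card * T.card : ℕ))
    (hdB : ∀ j k, dB j k = (((T ×ˢ U).filter fun tu => tu.2 k = tu.1 j).card : ℝ) / (T.card * U.card : ℕ))
    (hdC : ∀ k i, dC k i = (((U ×ˢ S).filter fun us => us.2 i = us.1 k).card : ℝ) / (U.card * S.card : ℕ))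
    (k : Fin n) (J I : Finset (Fin n)) (q η : ℝ) (hq : 0 < q) (hη : 0 < η)
    (hJ : ∀ j ∈ J, 1 / (n : ℝ) ^ 2 ≤ dB j k) (hI : ∀ i ∈ I, 1 / (n : ℝ) ^ 2 ≤ dC k i)
    (hlow : 2 * q ≤ ∑ v : Fin n, ((U.filter fun u => u k = v).card : ℝ) / U.card *
        ((((T.filter fun t => t⁻¹ v ∈ J).card : ℝ) / T.card) *
          (((S.filter fun s => s⁻¹ v ∈ I).card : ℝ) / S.card)))
    (hΨ : ∑ i ∈ I, ∑ j ∈ J, dA i j * dB j k * dC k i ≤ η / n)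
    (hηq : 81 * (1 + Real.log n) ^ 4 * η ≤ 2 * q ^ 2) :
    ((S.card * T.card * U.card : ℕ) : ℝ) ≤
      9600 ^ 2 * 9 ^ 4 * (1 + Real.log n) ^ 10 *
        (Real.log (6 * n.factorial / (S.card * T.card : ℕ))) ^ 2 * n * η * B / q ^ 4 := by
  classical
  /- 0. scalars -/
  have hn1 : 1 ≤ n := by omega
  have hnR : (2 : ℝ) ≤ n := by exact_mod_cast hn
  have hn0 : (0 : ℝ) < n := by linarith
  have hn2 : (0 : ℝ) < (n : ℝ) ^ 2 := by positivity
  set G : ℝ := 1 + Real.log n with hG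
  have hG1 : 1 ≤ G := by
    rw [hG]; linarith [Real.log_nonneg (show (1 : ℝ) ≤ n by linarith)]
  have hG0 : 0 < G := by linarith
  set cS : ℝ := (S.card : ℝ) with hcS
  set cT : ℝ := (T.card : ℝ) with hcT
  set cU : ℝ := (U.card : ℝ) with hcU
  have hcS0 : 0 < cS := by rw [hcS]; exact_mod_cast hS0.card_pos
  have hcT0 : 0 < cT := by rw [hcT]; exact_mod_cast hT0.card_pos
  have hcU0 : 0 < cU := by rw [hcU]; exact_mod_cast hU0.card_pos
  have hβe : ((T.card * U.card : ℕ) : ℝ) = cT * cU := by push_cast; rw [hcT, hcU]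
  have hγe : ((U.card * S.card : ℕ) : ℝ) = cU * cS := by push_cast; rw [hcU, hcS]
  have hTfil : ∀ (p : Equiv.Perm (Fin n) → Prop) [DecidablePred p], ((T.filter p).card : ℝ) ≤ cT :=
    fun p _ => by rw [hcT]; exact_mod_cast Finset.card_filter_le _ _
  have hSfil : ∀ (p : Equiv.Perm (Fin n) → Prop) [DecidablePred p], ((S.filter p).card : ℝ) ≤ cS :=
    fun p _ => by rw [hcS]; exact_mod_cast Finset.card_filter_le _ _
  /- 1. profiles: nonnegativity, column sums of `dB`, row sums of `dC` -/
  set mB : Fin n → Fin n → ℝ :=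
    fun j k' => (((T ×ˢ U).filter fun tu => tu.2 k' = tu.1 j).card : ℝ) with hmB
  set mC : Fin n → Fin n → ℝ :=
    fun k' i => (((U ×ˢ S).filter fun us => us.2 i = us.1 k').card : ℝ) with hmC
  have hdB' : ∀ j k', dB j k' = mB j k' / (cT * cU) := fun j k' => by rw [hdB, hβe]
  have hdC' : ∀ k' i, dC k' i = mC k' i / (cU * cS) := fun k' i => by rw [hdC, hγe]
  have hmB0 : ∀ j k', 0 ≤ mB j k' := fun j k' => by simp only [hmB]; exact Nat.cast_nonneg _
  have hmC0 : ∀ k' i, 0 ≤ mC k' i := fun k' i => by simp only [hmC]; exact Nat.cast_nonneg _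
  have hdA0 : ∀ i j, 0 ≤ dA i j := fun i j => by rw [hdA]; positivity
  have hdB0 : ∀ j k', 0 ≤ dB j k' := fun j k' =>
    (hdB' j k').symm ▸ div_nonneg (hmB0 j k') (mul_pos hcT0 hcU0).le
  have hdC0 : ∀ k' i, 0 ≤ dC k' i := fun k' i =>
    (hdC' k' i).symm ▸ div_nonneg (hmC0 k' i) (mul_pos hcU0 hcS0).le
  have hcolB : ∀ k', ∑ j : Fin n, dB j k' = 1 := by
    intro k'
    have h := sum_pairMarginal_fst T U k'
    have h' : ∑ j : Fin n, mB j k' = cT * cU := by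
      simp only [hmB, hcT, hcU]; exact_mod_cast h
    simp_rw [hdB' _ k']
    rw [← Finset.sum_div, h', div_self (mul_pos hcT0 hcU0).ne']
  have hrowC : ∀ k', ∑ i : Fin n, dC k' i = 1 := by
    intro k'
    have h := sum_pairMarginal_snd U S k'
    have h' : ∑ i : Fin n, mC k' i = cU * cS := by
      simp only [hmC, hcU, hcS]; exact_mod_cast h
    simp_rw [hdC' k']
    rw [← Finset.sum_div, h', div_self (mul_pos hcU0 hcS0).ne']
  have hdB1 : ∀ j k', dB j k' ≤ 1 := fun j k' => by
    rw [← hcolB k']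
    exact Finset.single_le_sum (f := fun j => dB j k') (fun j _ => hdB0 j k') (Finset.mem_univ j)
  have hdC1 : ∀ k' i, dC k' i ≤ 1 := fun k' i => by
    rw [← hrowC k']
    exact Finset.single_le_sum (f := fun i => dC k' i) (fun i _ => hdC0 k' i) (Finset.mem_univ i)
  /- 2. dyadic levels -/
  set ℓJ : Fin n → ℕ := fun j => ⌊Real.logb 2 (1 / dB j k)⌋₊ with hℓJ
  set ℓI : Fin n → ℕ := fun i => ⌊Real.logb 2 (1 / dC k i)⌋₊ with hℓI
  set Lm : ℕ := ⌊Real.logb 2 ((n : ℝ) ^ 2)⌋₊ with hLm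
  have hinv : 1 / (1 / (n : ℝ) ^ 2) = (n : ℝ) ^ 2 := one_div_one_div _
  have hℓJle : ∀ j ∈ J, ℓJ j ≤ Lm := by
    intro j hj
    have h := dyadicLevel_mono (dB j k) (1 / (n : ℝ) ^ 2) (by positivity) (hJ j hj)
    rw [hinv] at h
    exact h
  have hℓIle : ∀ i ∈ I, ℓI i ≤ Lm := by
    intro i hi
    have h := dyadicLevel_mono (dC k i) (1 / (n : ℝ) ^ 2) (by positivity) (hI i hi)
    rw [hinv] at h
    exact h
  have hLc : (Lm : ℝ) + 1 ≤ 3 * G := by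
    have h := dyadicLevel_count n hn1
    rw [← hLm] at h
    push_cast at h
    rw [hG]; exact h
  have hLc0 : (0 : ℝ) < (Lm : ℝ) + 1 := by positivity
  /- 3. the hub mass is bi-additive over blocks -/
  set μ : Fin n → ℝ := fun v => ((U.filter fun u => u k = v).card : ℝ) / cU with hμ
  have hμ0 : ∀ v, 0 ≤ μ v := fun v => by rw [hμ]; exact div_nonneg (Nat.cast_nonneg _) hcU0.le
  set g : Fin n → Fin n → ℝ := fun j i => ∑ v : Fin n, μ v *
    (((T.filter fun t => t j = v).card : ℝ) / cT) * (((S.filter fun s => s i = v).card : ℝ) / cS) with hg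
  have hg0 : ∀ j ∈ J, ∀ i ∈ I, 0 ≤ g j i := fun j _ i _ => by
    rw [hg]
    exact Finset.sum_nonneg fun v _ => mul_nonneg (mul_nonneg (hμ0 v)
      (div_nonneg (Nat.cast_nonneg _) hcT0.le)) (div_nonneg (Nat.cast_nonneg _) hcS0.le)
  -- the mass of a block as a double sum of `g`
  have hmass : ∀ J' I' : Finset (Fin n),
      ∑ v : Fin n, μ v * (((T.filter fun t => t⁻¹ v ∈ J').card : ℝ) / cT) *
          (((S.filter fun s => s⁻¹ v ∈ I').card : ℝ) / cS) = ∑ j ∈ J', ∑ i ∈ I', g j i := by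
    intro J' I'
    rw [hubDyadic_mass_eq_sum_blocks S T μ cS cT J' I']
  -- the hypothesis `hlow` in this vocabulary
  have hlow' : 2 * q ≤ ∑ j ∈ J, ∑ i ∈ I, g j i := by
    rw [← hmass J I]
    calc 2 * q ≤ _ := hlow
      _ = _ := Finset.sum_congr rfl fun v _ => by rw [hμ, hcS, hcT, hcU]; ring
  /- 4. pigeonhole: one level block carries `≥ 2q/(Lm+1)² ≥ 2q/(9G²)` -/
  obtain ⟨a, b, -, -, hblock⟩ := levelBlock_pigeonhole J I g hg0 ℓJ ℓI Lm hℓJle hℓIle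
  set J₀ : Finset (Fin n) := J.filter (fun j => ℓJ j = a) with hJ₀
  set I₀ : Finset (Fin n) := I.filter (fun i => ℓI i = b) with hI₀
  have hJ₀sub : J₀ ⊆ J := Finset.filter_subset _ _
  have hI₀sub : I₀ ⊆ I := Finset.filter_subset _ _
  set q' : ℝ := q / (9 * G ^ 2) with hq'
  have hq'0 : 0 < q' := by rw [hq']; positivity
  have hq'le : 2 * q' ≤ 2 * q / ((Lm : ℝ) + 1) ^ 2 := by
    rw [hq', mul_div_assoc', div_le_div_iff₀ (by positivity) (by positivity)]
    have h1 : ((Lm : ℝ) + 1) ^ 2 ≤ (3 * G) ^ 2 := pow_le_pow_left₀ hLc0.le hLc 2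
    nlinarith [h1, hq.le]
  have hlow₀ : 2 * q' ≤ ∑ v : Fin n, ((U.filter fun u => u k = v).card : ℝ) / U.card *
      ((((T.filter fun t => t⁻¹ v ∈ J₀).card : ℝ) / T.card) *
        (((S.filter fun s => s⁻¹ v ∈ I₀).card : ℝ) / S.card)) := by
    have e : ∑ v : Fin n, ((U.filter fun u => u k = v).card : ℝ) / U.card *
        ((((T.filter fun t => t⁻¹ v ∈ J₀).card : ℝ) / T.card) *
          (((S.filter fun s => s⁻¹ v ∈ I₀).card : ℝ) / S.card)) = ∑ j ∈ J₀, ∑ i ∈ I₀, g j i := by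
      rw [← hmass J₀ I₀]
      exact Finset.sum_congr rfl fun v _ => by rw [hμ, hcS, hcT, hcU]; ring
    rw [e]
    calc 2 * q' ≤ 2 * q / ((Lm : ℝ) + 1) ^ 2 := hq'le
      _ ≤ (∑ j ∈ J, ∑ i ∈ I, g j i) / ((Lm : ℝ) + 1) ^ 2 :=
          div_le_div_of_nonneg_right hlow' (by positivity)
      _ ≤ ∑ j ∈ J₀, ∑ i ∈ I₀, g j i := hblock
  /- 5. dyadic link bounds on the block -/
  set β : ℝ := (1 / 2 : ℝ) ^ (a + 1) with hβ
  set γ : ℝ := (1 / 2 : ℝ) ^ (b + 1) with hγ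
  have hβ0 : 0 < β := by rw [hβ]; positivity
  have hγ0 : 0 < γ := by rw [hγ]; positivity
  have hJ₀w : ∀ j ∈ J₀, β ≤ dB j k ∧ dB j k ≤ 2 * β := by
    intro j hj
    rw [hJ₀, Finset.mem_filter] at hj
    obtain ⟨hjJ, hja⟩ := hj
    have hpos : 0 < dB j k := lt_of_lt_of_le (by positivity) (hJ j hjJ)
    have h := dyadicLevel_bounds (dB j k) hpos (hdB1 j k)
    have hlev : ⌊Real.logb 2 (1 / dB j k)⌋₊ = a := hja
    rw [hlev] at h
    refine ⟨h.1.le, ?_⟩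
    rw [hβ, pow_succ]
    linarith [h.2]
  have hI₀w : ∀ i ∈ I₀, γ ≤ dC k i ∧ dC k i ≤ 2 * γ := by
    intro i hi
    rw [hI₀, Finset.mem_filter] at hi
    obtain ⟨hiI, hib⟩ := hi
    have hpos : 0 < dC k i := lt_of_lt_of_le (by positivity) (hI i hiI)
    have h := dyadicLevel_bounds (dC k i) hpos (hdC1 k i)
    have hlev : ⌊Real.logb 2 (1 / dC k i)⌋₊ = b := hib
    rw [hlev] at h
    refine ⟨h.1.le, ?_⟩
    rw [hγ, pow_succ]
    linarith [h.2]
  /- 6. the block weight -/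
  have hΨ₀ : ∑ i ∈ I₀, ∑ j ∈ J₀, dA i j * dB j k * dC k i ≤ η / n := by
    refine le_trans ?_ hΨ
    calc ∑ i ∈ I₀, ∑ j ∈ J₀, dA i j * dB j k * dC k i
        ≤ ∑ i ∈ I₀, ∑ j ∈ J, dA i j * dB j k * dC k i :=
          Finset.sum_le_sum fun i _ => Finset.sum_le_sum_of_subset_of_nonneg hJ₀sub
            fun j _ _ => mul_nonneg (mul_nonneg (hdA0 i j) (hdB0 j k)) (hdC0 k i)
      _ ≤ ∑ i ∈ I, ∑ j ∈ J, dA i j * dB j k * dC k i :=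
          Finset.sum_le_sum_of_subset_of_nonneg hI₀sub fun i _ _ =>
            Finset.sum_nonneg fun j _ => mul_nonneg (mul_nonneg (hdA0 i j) (hdB0 j k)) (hdC0 k i)
  /- 7. hub masses of the block: `Σ_{J₀} dB ≥ 2q'`, `Σ_{I₀} dC ≥ 2q'` -/
  have key2U : ∀ x y : ℝ, x / cU * (y / cT) = x * y / (cT * cU) := by
    intro x y; rw [div_mul_div_comm, mul_comm cU cT]
  have key2S : ∀ x y : ℝ, x / cU * (y / cS) = x * y / (cU * cS) := by
    intro x y; rw [div_mul_div_comm]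
  have hσ : 2 * q' ≤ ∑ j ∈ J₀, dB j k := by
    have hcol := sum_pairMarginal_col_block_eq T U J₀ k
    have hcolR : ∑ j ∈ J₀, mB j k = ∑ v : Fin n,
        ((U.filter fun u => u k = v).card : ℝ) * ((T.filter fun t => t⁻¹ v ∈ J₀).card : ℝ) := by
      simp only [hmB]; exact_mod_cast hcol
    have e1 : ∑ j ∈ J₀, dB j k = ∑ v : Fin n, ((U.filter fun u => u k = v).card : ℝ) / cU *
        (((T.filter fun t => t⁻¹ v ∈ J₀).card : ℝ) / cT) := by
      rw [Finset.sum_congr rfl fun j _ => hdB' j k, ← Finset.sum_div, hcolR, Finset.sum_div]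
      refine Finset.sum_congr rfl fun v _ => ?_
      rw [key2U]
    rw [e1]
    refine hlow₀.trans (Finset.sum_le_sum fun v _ => ?_)
    rw [← hcS, ← hcT, ← hcU]
    have hY1 : ((S.filter fun s => s⁻¹ v ∈ I₀).card : ℝ) / cS ≤ 1 := by
      rw [div_le_one hcS0]; exact hSfil _
    have h0 : 0 ≤ ((U.filter fun u => u k = v).card : ℝ) / cU *
        (((T.filter fun t => t⁻¹ v ∈ J₀).card : ℝ) / cT) :=
      mul_nonneg (div_nonneg (Nat.cast_nonneg _) hcU0.le) (div_nonneg (Nat.cast_nonneg _) hcT0.le)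
    calc ((U.filter fun u => u k = v).card : ℝ) / cU *
          ((((T.filter fun t => t⁻¹ v ∈ J₀).card : ℝ) / cT) *
            (((S.filter fun s => s⁻¹ v ∈ I₀).card : ℝ) / cS))
        = ((U.filter fun u => u k = v).card : ℝ) / cU *
            (((T.filter fun t => t⁻¹ v ∈ J₀).card : ℝ) / cT) *
            ((((S.filter fun s => s⁻¹ v ∈ I₀).card : ℝ) / cS)) := by ring
      _ ≤ ((U.filter fun u => u k = v).card : ℝ) / cU *
            (((T.filter fun t => t⁻¹ v ∈ J₀).card : ℝ) / cT) * 1 :=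
          mul_le_mul_of_nonneg_left hY1 h0
      _ = _ := mul_one _
  have hρ : 2 * q' ≤ ∑ i ∈ I₀, dC k i := by
    have hrow := sum_pairMarginal_row_block_eq U S I₀ k
    have hrowR : ∑ i ∈ I₀, mC k i = ∑ v : Fin n,
        ((U.filter fun u => u k = v).card : ℝ) * ((S.filter fun s => s⁻¹ v ∈ I₀).card : ℝ) := by
      simp only [hmC]; exact_mod_cast hrow
    have e1 : ∑ i ∈ I₀, dC k i = ∑ v : Fin n, ((U.filter fun u => u k = v).card : ℝ) / cU *
        (((S.filter fun s => s⁻¹ v ∈ I₀).card : ℝ) / cS) := by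
      rw [Finset.sum_congr rfl fun i _ => hdC' k i, ← Finset.sum_div, hrowR, Finset.sum_div]
      refine Finset.sum_congr rfl fun v _ => ?_
      rw [key2S]
    rw [e1]
    refine hlow₀.trans (Finset.sum_le_sum fun v _ => ?_)
    rw [← hcS, ← hcT, ← hcU]
    have hX1 : ((T.filter fun t => t⁻¹ v ∈ J₀).card : ℝ) / cT ≤ 1 := by
      rw [div_le_one hcT0]; exact hTfil _
    have h0 : 0 ≤ ((U.filter fun u => u k = v).card : ℝ) / cU *
        (((S.filter fun s => s⁻¹ v ∈ I₀).card : ℝ) / cS) :=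
      mul_nonneg (div_nonneg (Nat.cast_nonneg _) hcU0.le) (div_nonneg (Nat.cast_nonneg _) hcS0.le)
    calc ((U.filter fun u => u k = v).card : ℝ) / cU *
          ((((T.filter fun t => t⁻¹ v ∈ J₀).card : ℝ) / cT) *
            (((S.filter fun s => s⁻¹ v ∈ I₀).card : ℝ) / cS))
        = ((U.filter fun u => u k = v).card : ℝ) / cU *
            (((S.filter fun s => s⁻¹ v ∈ I₀).card : ℝ) / cS) *
            ((((T.filter fun t => t⁻¹ v ∈ J₀).card : ℝ) / cT)) := by ring
      _ ≤ ((U.filter fun u => u k = v).card : ℝ) / cU *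
            (((S.filter fun s => s⁻¹ v ∈ I₀).card : ℝ) / cS) * 1 :=
          mul_le_mul_of_nonneg_left hX1 h0
      _ = _ := mul_one _
  /- 8. the two block lemmas -/
  have hηq' : η ≤ 2 * q' ^ 2 := by
    have e : 2 * q' ^ 2 = 2 * q ^ 2 / (81 * G ^ 4) := by
      rw [hq']; field_simp; ring
    rw [e, le_div_iff₀ (by positivity)]
    calc η * (81 * G ^ 4) = 81 * G ^ 4 * η := by ring
      _ ≤ 2 * q ^ 2 := by rw [hG]; exact hηq
  have hcard := hubBlock_card_le hn1 hTPP hS0 hT0 hU0 dA dB dC hdA hdB hdC k J₀ I₀ β γ q' η hβ0 hγ0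
    hq'0 hJ₀w hI₀w hσ hρ hΨ₀ hηq'
  set W : ℝ := 9600 * (1 + Real.log n) * n * Real.log (6 * n.factorial / (S.card * T.card : ℕ)) with hW
  have hvol := hubBlock_volume_le hn1 B hB hTPP hS0 hT0 hU0 dA dB dC hdA hdB hdC k J₀ I₀ β γ q' η W
    hβ0 hγ0 hq'0 hη hJ₀w hI₀w hlow₀ hΨ₀ hcard
  /- 9. arithmetic: `W²η B/(q'⁴ n) = 9600²·9⁴·G^{10}·L²·n·η·B/q⁴` -/
  refine hvol.trans (le_of_eq ?_)
  rw [hW, hq', ← hG]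
  field_simp

end Summit.MatrixMultiplication.MatrixMultiplication.Theorems.PolynomialSlack
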